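import Summits.ValiantsHypothesis.ValiantsHypothesis.Theorems.GrenetZeonDualUnipotentThreeHalvesHeavyTopLevelTwoTools

/-!
# `GrenetZeon.DualUnipotentThreeHalves` (stmt-ValiantsHypothesis-24318), R2 heavy-top instrument — THEOREM C(7) PORT, KIT 1:
# trace identities of a nilpotent matrix space, the two-functional lemma, the annihilator dimension bound

Experiment cell «val-heavytop-census» (D-0160), engine seat val-htc-eng-1 g4.  Theorem C(7) (lead g0 `ROADMAP-codim1.md` §1–§6,
lead-g2 `THMC-CHECK.md`): «a nilpotent subspace `V ≤ M₇(ℂ)` with `J₇ ∈ V` and `dim V = 20` is reducible» — the one non-kernel input of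
the census row `(5,7)` (✓ `HeavyTopIotaOfThmC.heavyTopInst_five_seven_of_thmC7`).  The port (this seat, files `…HeavyTopThmC*`) replaces the
pencil framework (slack identity / Gerstenhaber powers lemma / Thm A / Thm B) by: graded limit + trace-orthogonality COUNT (one deficient
height `h*`) + POINT EQUATIONS in the weight-`(−s)` datum `c` obtained as traces of powers of explicit members of the graded space +
kernel-checked Nullstellensatz certificates (`linear_combination`).  THIS FILE is the size-free analytic kit:

* `trace_pow_eq_zero_of_isNilpotent` — nilpotent `M` ⇒ `tr(M^k) = 0` (`k ≥ 1`);
* `mul_idem_pow`, `trace_pow_mul_eq_zero_of_isNilpotent` — for an idempotent `P` commuting with `M`: `(M P)^k = M^k P`, hence nilpotent `M` ⇒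
  `tr(M^k P) = 0` (per-class traces of a class-preserving member: `P` = the diagonal projector onto a residue class);
* `trace_mul_eq_zero_of_mem` — `X, Y` in a nilpotent space ⇒ `tr(XY) = 0` (polarised `tr(M²) = 0`);
* `trace_mul_pow_eq_zero_of_mem`, `trace_mixed_eq_zero_of_mem` — the first-order and mixed second-order identities (✓ `HeavyTopBorderOrthogonality`,
  ✓ `HeavyTopLevelTwoTools`) in «members of a nilpotent space» form;
* `forall_eq_zero_or_of_mul_eq_zero` — two linear functionals whose product vanishes on a subspace: one of them vanishes there;
* `finrank_add_finrank_le_of_dotProduct_eq_zero` — `N ⊥ P` for the dot product on `Fin n → ℂ` ⇒ `dim N + dim P ≤ n` (via ✓ `dotProductEquiv` and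
  `Subspace.finrank_add_finrank_dualAnnihilator_eq`).

Honest framing: infrastructure for the instrument's kernel port of Thm C(7); nothing here proves or refutes `HeavyTopLaw`/`HeavyTopSlowLaw`,
24318, S3 or 8062; `VP ≠ VNP` is NOT proved.  No definitions.  [folklore; this seat]
-/

noncomputable section

-- single-conjunct layout: Sub = Summit, duplicated namespace component intended
set_option linter.dupNamespace false

namespace Summit.ValiantsHypothesis.ValiantsHypothesis.Theorems.GrenetZeon.HeavyTopThmCTraceKit

open Matrix
open Summit.ValiantsHypothesis.ValiantsHypothesis.Theorems.GrenetZeon.HeavyTopBorderOrthogonality (trace_firstOrder_eq_zero)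
open Summit.ValiantsHypothesis.ValiantsHypothesis.Theorems.GrenetZeon.HeavyTopLevelTwoTools (trace_mixed_eq_zero)

/-! ## Traces of powers -/

/-- A nilpotent matrix has trace-free positive powers. -/
theorem trace_pow_eq_zero_of_isNilpotent {n : Type*} [Fintype n] [DecidableEq n] (M : Matrix n n ℂ) (hM : IsNilpotent M)
    {k : ℕ} (hk : 1 ≤ k) : Matrix.trace (M ^ k) = 0 :=
  (Matrix.isNilpotent_trace_of_isNilpotent (hM.pow_of_pos (by omega))).eq_zero

/-- For an idempotent `P` commuting with `M`: `(M P)^k = M^k P` (`k ≥ 1`). -/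
theorem mul_idem_pow {n : Type*} [Fintype n] [DecidableEq n] (M P : Matrix n n ℂ) (hcomm : M * P = P * M) (hP : P * P = P)
    (k : ℕ) : (M * P) ^ (k + 1) = M ^ (k + 1) * P := by
  induction k with
  | zero => rw [zero_add, pow_one, pow_one]
  | succ k ih =>
    rw [pow_succ, ih, pow_succ M (k + 1)]
    calc M ^ (k + 1) * P * (M * P) = M ^ (k + 1) * (P * M) * P := by simp only [Matrix.mul_assoc]
      _ = M ^ (k + 1) * (M * P) * P := by rw [← hcomm]
      _ = M ^ (k + 1) * M * (P * P) := by simp only [Matrix.mul_assoc]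
      _ = M ^ (k + 1) * M * P := by rw [hP]

/-- **Per-class traces.**  For an idempotent `P` commuting with a nilpotent `M`: `tr(M^k P) = 0` (`k ≥ 1`).  (With `P` the diagonal
projector onto a residue class of indices preserved by `M`, this is the trace of the `k`-th power of the corresponding diagonal block.) -/
theorem trace_pow_mul_eq_zero_of_isNilpotent {n : Type*} [Fintype n] [DecidableEq n] (M P : Matrix n n ℂ) (hM : IsNilpotent M)
    (hcomm : M * P = P * M) (hP : P * P = P) {k : ℕ} (hk : 1 ≤ k) : Matrix.trace (M ^ k * P) = 0 := by
  obtain ⟨j, rfl⟩ : ∃ j, k = j + 1 := ⟨k - 1, by omega⟩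
  rw [← mul_idem_pow M P hcomm hP j]
  have hMP : IsNilpotent (M * P) := by
    obtain ⟨N, hN⟩ := hM
    refine ⟨N + 1, ?_⟩
    rw [mul_idem_pow M P hcomm hP N, pow_succ, hN, Matrix.zero_mul, Matrix.zero_mul]
  exact trace_pow_eq_zero_of_isNilpotent _ hMP (by omega)

/-! ## Identities in a nilpotent space -/

/-- **Trace orthogonality.**  Two members `X, Y` of a linear space of nilpotent matrices have `tr(XY) = 0` (polarise `tr(M²) = 0`). -/
theorem trace_mul_eq_zero_of_mem {n : Type*} [Fintype n] [DecidableEq n] (W : Submodule ℂ (Matrix n n ℂ))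
    (hW : ∀ M ∈ W, IsNilpotent M) {X Y : Matrix n n ℂ} (hX : X ∈ W) (hY : Y ∈ W) : Matrix.trace (X * Y) = 0 := by
  have h2 : ∀ M ∈ W, Matrix.trace (M ^ 2) = 0 := fun M hM => trace_pow_eq_zero_of_isNilpotent M (hW M hM) (by norm_num)
  have hXY := h2 _ (W.add_mem hX hY)
  rw [pow_two, Matrix.add_mul, Matrix.mul_add, Matrix.mul_add, Matrix.trace_add, Matrix.trace_add, Matrix.trace_add, ← pow_two, ← pow_two,
    h2 X hX, h2 Y hY, Matrix.trace_mul_comm Y X] at hXY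
  linear_combination hXY / 2

/-- **First order.**  `A, B` in a nilpotent space ⇒ `tr(B A^k) = 0`. [✓ `trace_firstOrder_eq_zero`] -/
theorem trace_mul_pow_eq_zero_of_mem {n : Type*} [Fintype n] [DecidableEq n] (W : Submodule ℂ (Matrix n n ℂ))
    (hW : ∀ M ∈ W, IsNilpotent M) {A B : Matrix n n ℂ} (hA : A ∈ W) (hB : B ∈ W) (k : ℕ) : Matrix.trace (B * A ^ k) = 0 := by
  have h := trace_firstOrder_eq_zero A B (m := k + 1) (by omega) (fun y => ?_)
  · simpa using h
  · exact trace_pow_eq_zero_of_isNilpotent _ (hW _ (W.add_mem hA (W.smul_mem y hB))) (by omega)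

/-- **Mixed second order.**  `A, E, X` in a nilpotent space ⇒ `Σ_{a<m} tr(X (A^a E A^{m−1−a})) = 0`. [✓ `trace_mixed_eq_zero`] -/
theorem trace_mixed_eq_zero_of_mem {n : Type*} [Fintype n] [DecidableEq n] (W : Submodule ℂ (Matrix n n ℂ))
    (hW : ∀ M ∈ W, IsNilpotent M) {A E X : Matrix n n ℂ} (hA : A ∈ W) (hE : E ∈ W) (hX : X ∈ W) (m : ℕ) :
    ∑ a ∈ Finset.range m, Matrix.trace (X * (A ^ a * E * A ^ (m - 1 - a))) = 0 := by
  refine trace_mixed_eq_zero A E X m fun x z => ?_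
  exact trace_pow_eq_zero_of_isNilpotent _ (hW _ (W.add_mem (W.add_mem hA (W.smul_mem z hE)) (W.smul_mem x hX))) (by omega)

/-! ## Two functionals with vanishing product -/

/-- If the product of two linear functionals vanishes on a subspace `L`, one of them vanishes on `L` (test at `x`, `y`, `x + y`). -/
theorem forall_eq_zero_or_of_mul_eq_zero {V : Type*} [AddCommGroup V] [Module ℂ V] (L : Submodule ℂ V) (f g : V →ₗ[ℂ] ℂ)
    (h : ∀ x ∈ L, f x * g x = 0) : (∀ x ∈ L, f x = 0) ∨ (∀ x ∈ L, g x = 0) := by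
  by_contra hne
  rw [not_or, not_forall, not_forall] at hne
  obtain ⟨⟨x, hx⟩, ⟨y, hy⟩⟩ := hne
  rw [Classical.not_imp] at hx hy
  have h1 : g x = 0 := by simpa [hx.2] using h x hx.1
  have h2 : f y = 0 := by simpa [hy.2] using h y hy.1
  have h3 := h (x + y) (L.add_mem hx.1 hy.1)
  rw [map_add, map_add, h1, h2, zero_add, add_zero] at h3
  rcases mul_eq_zero.1 h3 with h4 | h4
  · exact hx.2 h4
  · exact hy.2 h4

/-! ## Annihilator dimension for the dot product -/

/-- **Dot-product annihilator bound.**  If `q ⬝ᵥ p = 0` for all `p ∈ P`, `q ∈ N` (subspaces of `Fin n → ℂ`), then `dim N + dim P ≤ n`. -/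
theorem finrank_add_finrank_le_of_dotProduct_eq_zero {n : ℕ} (P N : Submodule ℂ (Fin n → ℂ))
    (h : ∀ q ∈ N, ∀ p ∈ P, q ⬝ᵥ p = 0) : Module.finrank ℂ N + Module.finrank ℂ P ≤ n := by
  classical
  set e := dotProductEquiv ℂ (Fin n) with he
  have hle : N.map (e : (Fin n → ℂ) →ₗ[ℂ] Module.Dual ℂ (Fin n → ℂ)) ≤ P.dualAnnihilator := by
    rintro φ ⟨q, hq, rfl⟩
    rw [Submodule.mem_dualAnnihilator]
    intro p hp
    show (e q) p = 0
    rw [he, dotProductEquiv_apply_apply]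
    exact h q hq p hp
  have h1 : Module.finrank ℂ (N.map (e : (Fin n → ℂ) →ₗ[ℂ] Module.Dual ℂ (Fin n → ℂ))) = Module.finrank ℂ N :=
    LinearEquiv.finrank_map_eq e N
  have h2 := Submodule.finrank_mono hle
  have h3 := Subspace.finrank_add_finrank_dualAnnihilator_eq P
  rw [Module.finrank_fin_fun] at h3
  omega

end Summit.ValiantsHypothesis.ValiantsHypothesis.Theorems.GrenetZeon.HeavyTopThmCTraceKit

end
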